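import Literature.MathematicalPhysics.QuantumFieldTheory.Balaban1983to89.B1Sect3Statements
import Literature.MathematicalPhysics.QuantumFieldTheory.Balaban1983to89.B1RG242

/-!
# `Balaban1983to89.B1Eq333Decomposition` — [Balaban1982Higgs1] (3.42) p. 619 (the effect of the translation (3.41) on
the background field: A^{(k)} = A′^{(k)} + B^{(k+1)}, whose middle equality is the adjoint form of the
renormalization-group identity (2.41)) and (3.33) p. 617 (the decomposition A = A′^{(0),ε} + … + A′^{(k−1),ε} +
A^{(k),ε} of the initial field after k steps), PROVED on the tree's concrete carrier of B1 Sect. 2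
(`B1RG242.StepData` / `B1RG242.Tower`)

HONEST FRAMING (cell `lit-balaban`, verbatim): statement-level skeleton of published theorems with citation tags;
proofs where landed; nothing here is a claim about the Yang–Mills mass gap.

CITATION HEADER.  T. Bałaban, *(Higgs)₂,₃ quantum fields in a finite volume. I. A lower bound*, Commun. Math.
Phys. **85** (1982) 603–626, doi:10.1007/bf01403506 [Balaban1982Higgs1] (cell paper B1; PDF held
`paper:balaban1982-cmp85-higgs23-i`, journal page = PDF page + 602; displays read as images on the x2 renders
`run/shared/lean/pub/pub-balaban/b2b-balaban-ref1/pages/1982-cmp85-higgs23-I/…-p010/p012/p015/p017-x2.png`).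
Unit `lit-balaban-p14` (Phase 2; SPARE row B1.Eq3.33 of PHASE2-TARGETS.md §G.5-12/G.5-23 taken after the seat's own
§G.3 line landed as `B1Eq314Proof`, p243148), SKELETON rows `B1.Eq3.33` (absent before this file) and
`B1.Eq3.41-3.42` (typed p239973: `B1Sect3Statements.transl310` + `B1LowerBound.bgField_add`, *"the middle identity
(composition law (2.14)/(2.66)) not proved"* — proved here).  HOME `run/shared/lean/pub/lit-balaban/`.

WHAT IS PRINTED (verbatim).  p. 619 [PDF 17]: *"This translation has the form A = A′ + aL⁻²C^{(k)}Q*B (3.41) and it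
separates the quadratic form in the fields A, B in the exponential function under the integral (3.38) into a sum of
the forms ½⟨B, Δ^{(k+1),L}B⟩ + ½⟨A′, (C^{(k)})⁻¹A′⟩. In the remaining part of the action the field A occurs only
through the function A^{(k)}, so let us write the effect of the translation on the field A^{(k)},
A^{(k)} = a_kG_kQ*_kA′ + a_kaL⁻²G_kQ*_kC^{(k)}Q*B = a_kG_kQ*_kA′ + a_{k+1}L⁻²G^η_{k+1}Q*_{k+1}B = A′^{(k)} + B^{(k+1)}.
(3.42)"*; p. 617 [PDF 15]: *"A^{(k),ε} = a_k(L^kε)⁻²G^ε_kQ*_kA (3.29)"* and *"At first let us notice that after k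
successive renormalization transformations together with the corresponding translations, the field A with which we
have started in the first step is represented as A = A′^{(0),ε} + A′^{(1),ε} + … + A′^{(k−1),ε} + A^{(k),ε}, (3.33)
where A′^{(j),ε} are given by the formula (3.29) with A′_j instead of A."*; p. 614 [PDF 12]: *"A = A′ +
aL⁻²C^{(0)}Q*B =: A′ + B^{(1)} (3.10)"*; p. 612 [PDF 10]: *"Q_{k+1}(A)G^ε_{k+1}(Ω,A) = (aa_k/a_{k+1})(L^kε)⁻²
Q(A)C^{(k),L^kε}(Ω,A)Q_k(A)G^ε_k(Ω,A), (2.41)"* and *"Using the identity G^ε_1(Ω,A) = C^{(0),ε}(Ω,A)"*.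

WHAT THIS MODULE PROVES (theorems only; no definition, no new `Prop` fact; axioms standard) — all on the carrier
`B1RG242.StepData` (one step k → k + 1: finite lattices `ι ⊃ κ ⊃ ν`, operators as real matrices, `S.α` ↤
a_k(L^kε)⁻², `S.β` ↤ a(L^{k+1}ε)⁻², `S.γ` ↤ a_{k+1}(L^{k+1}ε)⁻² (`B1RG242.StepData.γ_printed`), `S.Gk` ↤ G^ε_k (2.20),
`S.Ck` ↤ C^{(k),L^kε} (2.30), `S.Gk1` ↤ G^ε_{k+1}, `S.Qk1s = Q*_kQ*` ↤ Q*_{k+1}) resp. `B1RG242.Tower` (all levels),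
under the hypotheses B1RG242 already uses for (2.41)/(2.42): QQ* = 1, α + β ≠ 0, invertibility of the arguments of
G^ε_k (2.20) and C^{(k)} (2.30) (over ℝ these follow from m² > 0, `B1RG242.Tower.consistent_of_posDef`):
* `display241_adj` — the MIRRORED renormalization-group identity G^ε_{k+1}Q*_{k+1} = (α + β)·G^ε_kQ*_kC^{(k)}Q*, i.e.
  the form of (2.41) that (3.42) actually uses (B1RG242 proves the printed right-handed form Q_{k+1}G_{k+1} = …; the
  two are NOT formal consequences of each other without self-adjointness, so the mirrored one is derived here from
  (2.42) `display242` by the mirrored computation);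
* `eq342` — **(3.42) PROVED**: αG_kQ*_k(A′ + βC^{(k)}Q*B) = αG_kQ*_kA′ + γG_{k+1}Q*_{k+1}B, i.e. A^{(k)}[A′ + B^{(1)}]
  = A′^{(k)} + B^{(k+1)} (both printed equalities: the first is linearity, the second `display241_adj` with
  γ(α + β) = αβ, (2.13)); `eq342_printed` — the same in the vocabulary of the rows of record,
  `B1LowerBound.bgField (B1.aSeq a L k) (L^kε) …` ((3.29)) and `B1Sect3Statements.transl310` ((3.10)/(3.41)), with the
  printed coefficients a_k, a_{k+1} = `B1.aSeq a L (k+1)`, L^{k+1}ε;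
* `eq333` / `eq333_from_level_zero` — **(3.33) PROVED along a tower**: if at every level 1 ≤ j < k the block field is
  translated as in (3.41), A_j = A′_j + β_jC^{(j)}Q*A_{j+1}, then α₁G₁Q*₁A₁ = Σ_{j=1}^{k−1} α_jG_jQ*_jA′_j +
  α_kG_kQ*_kA_k, and with the level-0 translation (3.10) A = A′₀ + α₁G₁Q*₁A₁ (a₁ = a, G^ε_1 = C^{(0),ε}, p. 612) this is
  A = A′₀ + A′^{(1),ε} + … + A′^{(k−1),ε} + A^{(k),ε} — (3.33) with A′^{(0),ε} := A′₀ (by induction on k from `eq342`).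
Nothing else of pp. 617–619 is asserted ((3.34)–(3.40) are r12's rows; the probabilistic reading of (3.33) —
*"The fields A′_j … are independent Gaussian random variables with the covariances C^{(j),L^jε}"* — is the Gaussian
dictionary of `B1RG242`'s docstring (i) and of `B1Eq314Proof` (the splitting (3.11)/(3.41)), not re-derived here).
-/

namespace Literature.MathematicalPhysics.QuantumFieldTheory.Balaban1983to89.B1Eq333Decomposition

open Literature.MathematicalPhysics.QuantumFieldTheory.Balaban1983to89
open Matrix B1RG242 B1RG242.StepData B1Sect3Statements

/-! ## 1. One step: the mirrored (2.41) and (3.42) on `B1RG242.StepData` -/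

section OneStep

variable {ι κ ν : Type*} [Fintype ι] [Fintype κ] [Fintype ν] [DecidableEq ι] [DecidableEq κ] [DecidableEq ν]
variable (S : B1RG242.StepData ℝ ι κ ν)

/-- The renormalization-group identity (2.41) in the MIRRORED form used by (3.42):
G^ε_{k+1}Q*_{k+1} = (α + β)·G^ε_kQ*_kC^{(k),L^kε}Q*, α + β = (aa_k/a_{k+1})(L^kε)⁻² (`B1RG242.scalars_213`), under
QQ* = 1, α + β ≠ 0 and the invertibility of the arguments of G^ε_k (2.20) and C^{(k)} (2.30).  Proof: insert (2.42)
`display242` for G^ε_{k+1}, Q*_{k+1} = Q*_kQ*, and α²Q_kG_kQ*_k = (βP + α·1) − (C^{(k)})⁻¹ (`C_arg_eq`), (βP + α·1)Q* =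
(α + β)Q* (`Sm_mul_Qs`). [cite: Balaban1982Higgs1, (3.42) p.619] -/
theorem display241_adj (hQ : S.Q * S.Qs = 1) (hαβ : S.α + S.β ≠ 0) (hG : IsUnit (S.H + S.α • S.Pk))
    (hC : IsUnit (S.β • S.P + S.Δk)) :
    S.Gk1 * S.Qk1s = (S.α + S.β) • (S.Gk * S.Qks * S.Ck * S.Qs) := by
  have h242 := S.display242 hQ hαβ hG hC
  have hCD : S.Ck * (S.β • S.P + S.Δk) = 1 := S.mul_Ck hC
  have hSQ := S.Sm_mul_Qs hQ
  have hZ : S.α ^ 2 • (S.Qk * S.Gk * S.Qks) = (S.β • S.P + S.α • 1) - (S.β • S.P + S.Δk) := by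
    rw [S.C_arg_eq]; abel
  have t1 : S.Gk * S.Qks * S.Ck * (S.β • S.P + S.α • (1 : Matrix κ κ ℝ)) * S.Qs
      = (S.α + S.β) • (S.Gk * S.Qks * S.Ck * S.Qs) := by
    rw [Matrix.mul_assoc _ (S.β • S.P + S.α • 1) S.Qs, hSQ, Matrix.mul_smul]
  have t2 : S.Gk * S.Qks * S.Ck * (S.β • S.P + S.Δk) * S.Qs = S.Gk * S.Qks * S.Qs := by
    rw [Matrix.mul_assoc (S.Gk * S.Qks) S.Ck (S.β • S.P + S.Δk), hCD, Matrix.mul_one]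
  have step1 : S.Gk * S.Qks * S.Ck * (S.α ^ 2 • (S.Qk * S.Gk * S.Qks)) * S.Qs
      = (S.α + S.β) • (S.Gk * S.Qks * S.Ck * S.Qs) - S.Gk * S.Qks * S.Qs := by
    rw [hZ, Matrix.mul_sub, Matrix.sub_mul, t1, t2]
  have e : S.α ^ 2 • (S.Gk * S.Qks * S.Ck * S.Qk * S.Gk) * (S.Qks * S.Qs)
      = S.Gk * S.Qks * S.Ck * (S.α ^ 2 • (S.Qk * S.Gk * S.Qks)) * S.Qs := by
    simp only [Matrix.smul_mul, Matrix.mul_smul, Matrix.mul_assoc]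
  rw [h242, Qk1s, Matrix.add_mul, e, step1, ← Matrix.mul_assoc S.Gk S.Qks S.Qs]
  abel

/-- As operators: a_kaL⁻²·G_kQ*_kC^{(k)}Q* = a_{k+1}L⁻²·G_{k+1}Q*_{k+1} — the middle equality of (3.42), i.e.
αβ·G^ε_kQ*_kC^{(k)}Q* = γ·G^ε_{k+1}Q*_{k+1} with γ(α + β) = αβ ((2.13), `γ_mul`).
[cite: Balaban1982Higgs1, (3.42) p.619] -/
theorem eq342_op (hQ : S.Q * S.Qs = 1) (hαβ : S.α + S.β ≠ 0) (hG : IsUnit (S.H + S.α • S.Pk))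
    (hC : IsUnit (S.β • S.P + S.Δk)) :
    (S.α * S.β) • (S.Gk * S.Qks * S.Ck * S.Qs) = S.γ • (S.Gk1 * S.Qk1s) := by
  rw [display241_adj S hQ hαβ hG hC, smul_smul, S.γ_mul hαβ]

/-- **(3.42) p. 619, PROVED** on `B1RG242.StepData`: for every fluctuation field `A′` (on the k-th lattice `κ`) and
block field `B` (on the (k+1)-st lattice `ν`), the background field (3.29) of the translated field (3.41) splits as
αG^ε_kQ*_k(A′ + βC^{(k)}Q*B) = αG^ε_kQ*_kA′ + γG^ε_{k+1}Q*_{k+1}B, i.e. *"A^{(k)} = a_kG_kQ*_kA′ +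
a_kaL⁻²G_kQ*_kC^{(k)}Q*B = a_kG_kQ*_kA′ + a_{k+1}L⁻²G^η_{k+1}Q*_{k+1}B = A′^{(k)} + B^{(k+1)}"* (unit-lattice scalars
a_k, aL⁻², a_{k+1}L⁻² ↤ α, β, γ). [cite: Balaban1982Higgs1, (3.42) p.619] -/
theorem eq342 (hQ : S.Q * S.Qs = 1) (hαβ : S.α + S.β ≠ 0) (hG : IsUnit (S.H + S.α • S.Pk))
    (hC : IsUnit (S.β • S.P + S.Δk)) (A' : κ → ℝ) (B : ν → ℝ) :
    S.α • ((S.Gk * S.Qks) *ᵥ (A' + S.β • (S.Ck *ᵥ (S.Qs *ᵥ B))))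
      = S.α • ((S.Gk * S.Qks) *ᵥ A') + S.γ • ((S.Gk1 * S.Qk1s) *ᵥ B) := by
  have hop := eq342_op S hQ hαβ hG hC
  have h2 : S.γ • ((S.Gk1 * S.Qk1s) *ᵥ B) = (S.α * S.β) • ((S.Gk * S.Qks * S.Ck * S.Qs) *ᵥ B) := by
    rw [← Matrix.smul_mulVec, ← hop, Matrix.smul_mulVec]
  rw [h2, Matrix.mulVec_add, smul_add, Matrix.mulVec_smul, smul_smul]
  simp only [← Matrix.mulVec_mulVec]

/-- **(3.42) in the vocabulary of the rows of record** (`B1LowerBound.bgField` = (3.29), `B1Sect3Statements.transl310`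
= (3.10)/(3.41)) with the PRINTED coefficients: for α = a_k(L^kε)⁻², β = a(L^{k+1}ε)⁻² (a_k = `B1.aSeq a L k`,
(2.15)), A^{(k),ε}[A′ + a(L^{k+1}ε)⁻²C^{(k)}Q*B] = A′^{(k),ε} + B^{(k+1),ε}, where A^{(k),ε}[X] =
a_k(L^kε)⁻²G^ε_kQ*_kX and B^{(k+1),ε} = a_{k+1}(L^{k+1}ε)⁻²G^ε_{k+1}Q*_{k+1}B ((3.29) at k + 1, a_{k+1} =
aa_k/(aL⁻² + a_k) (2.13) = `B1.aSeq a L (k+1)`). [cite: Balaban1982Higgs1, (3.42) p.619] -/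
theorem eq342_printed {ι κ ν : Type} [Fintype ι] [Fintype κ] [Fintype ν] [DecidableEq ι] [DecidableEq κ]
    [DecidableEq ν] (S : B1RG242.StepData ℝ ι κ ν) {a L ℓ : ℝ} {k : ℕ} (ha : 0 < a) (hL : 1 < L) (hk : 1 ≤ k)
    (hℓ : 0 < ℓ) (hQ : S.Q * S.Qs = 1) (hG : IsUnit (S.H + S.α • S.Pk)) (hC : IsUnit (S.β • S.P + S.Δk))
    (hα : S.α = B1.aSeq a L k * (ℓ ^ 2)⁻¹) (hβ : S.β = a * ((L * ℓ) ^ 2)⁻¹) (A' : κ → ℝ) (B : ν → ℝ) :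
    B1LowerBound.bgField (B1.aSeq a L k) ℓ S.Gk.mulVecLin S.Qks.mulVecLin
        (transl310 S.β S.Ck.mulVecLin S.Qs.mulVecLin A' B)
      = B1LowerBound.bgField (B1.aSeq a L k) ℓ S.Gk.mulVecLin S.Qks.mulVecLin A'
        + B1LowerBound.bgField (B1.aSeq a L (k + 1)) (L * ℓ) S.Gk1.mulVecLin S.Qk1s.mulVecLin B := by
  have hak := B1.aSeq_pos ha hL hk
  have hL0 : 0 < L := lt_trans one_pos hL
  have hαβ : S.α + S.β ≠ 0 := by
    rw [hα, hβ]
    exact (add_pos (mul_pos hak (by positivity)) (mul_pos ha (by positivity))).ne'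
  have hγ := S.γ_printed ha hL hk hℓ hα hβ
  have h := eq342 S hQ hαβ hG hC A' B
  rw [hα, hγ] at h
  simp only [← Matrix.mulVec_mulVec] at h
  simp only [B1LowerBound.bgField, transl310, Matrix.mulVecLin_apply]
  exact h

end OneStep

/-! ## 2. All steps: the decomposition (3.33) along a `B1RG242.Tower` -/

section AllSteps

variable {ι : Type} [Fintype ι] [DecidableEq ι] (T : B1RG242.Tower ℝ ι)

/-- Level bookkeeping: the objects of level k + 1 of the tower ARE the "next" objects of the k-th step data —
G_{k+1} = (T.step k).Gk1, Q*_{k+1} = (T.step k).Qk1s, α_{k+1} = (T.step k).γ — under `Tower.Consistent`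
(Q_{k+1} = QQ_k, Q*_{k+1} = Q*_kQ*, (2.13)). [cite: Balaban1982Higgs1, (2.11)–(2.14) p.609] -/
theorem tower_next (h : T.Consistent) (k : ℕ) (hk : 1 ≤ k) :
    T.G (k + 1) = (T.step k).Gk1 ∧ T.Qks (k + 1) = (T.step k).Qk1s ∧ T.α (k + 1) = (T.step k).γ := by
  refine ⟨?_, ?_, ?_⟩
  · show (T.step (k + 1)).Gk = (T.step k).Gk1
    simp only [StepData.Gk, StepData.Gk1, StepData.Pk, StepData.Pk1, StepData.Qk1, StepData.Qk1s, StepData.γ,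
      Tower.step, h.Qk_succ k hk, h.Qks_succ k hk, h.α_succ k hk]
  · rw [h.Qks_succ k hk]; rfl
  · rw [h.α_succ k hk]; rfl

/-- (3.42) at level k of a consistent tower: α_kG_kQ*_k(A′ + β_kC^{(k)}Q*X) = α_kG_kQ*_kA′ + α_{k+1}G_{k+1}Q*_{k+1}X.
[cite: Balaban1982Higgs1, (3.42) p.619] -/
theorem eq342_tower (h : T.Consistent) (k : ℕ) (hk : 1 ≤ k) (A' : T.κ k → ℝ) (X : T.κ (k + 1) → ℝ) :
    T.α k • ((T.G k * T.Qks k) *ᵥ (A' + T.β k • (T.C k *ᵥ (T.Qs k *ᵥ X))))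
      = T.α k • ((T.G k * T.Qks k) *ᵥ A') + T.α (k + 1) • ((T.G (k + 1) * T.Qks (k + 1)) *ᵥ X) := by
  obtain ⟨hG1, hQ1, hα1⟩ := tower_next T h k hk
  rw [hG1, hQ1, hα1]
  exact eq342 (T.step k) (h.QQs k hk) (h.αβ_ne k hk) (h.G_arg k hk) (h.C_arg k hk) A' X

/-- **(3.33) p. 617, PROVED along a consistent tower** (levels j ≥ 1): if at every level 1 ≤ j < k the block field
A_j is translated as in (3.41), A_j = A′_j + β_jC^{(j)}Q*A_{j+1} (β_j = a(L^{j+1}ε)⁻²), then the level-1 background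
field decomposes into the fluctuation backgrounds plus the level-k background:
α₁G₁Q*₁A₁ = Σ_{j=1}^{k−1} α_jG_jQ*_jA′_j + α_kG_kQ*_kA_k, i.e. A^{(1),ε}[A₁] = Σ_{j=1}^{k−1} A′^{(j),ε} + A^{(k),ε}
(α_j = a_j(L^jε)⁻², (3.29)).  By induction on k from `eq342_tower`. [cite: Balaban1982Higgs1, (3.33) p.617] -/
theorem eq333 (h : T.Consistent) (A A' : ∀ j, T.κ j → ℝ) (k : ℕ) (hk : 1 ≤ k)
    (hA : ∀ j, 1 ≤ j → j < k → A j = A' j + T.β j • (T.C j *ᵥ (T.Qs j *ᵥ A (j + 1)))) :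
    T.α 1 • ((T.G 1 * T.Qks 1) *ᵥ A 1)
      = (∑ j ∈ Finset.Ico 1 k, T.α j • ((T.G j * T.Qks j) *ᵥ A' j)) + T.α k • ((T.G k * T.Qks k) *ᵥ A k) := by
  induction k with
  | zero => exact absurd hk (by omega)
  | succ n ih =>
      rcases Nat.lt_or_ge n 1 with hn | hn
      · -- k = 1: empty sum
        have hn0 : n = 0 := by omega
        subst hn0
        simp
      · have ih' := ih hn (fun j hj hjn => hA j hj (Nat.lt_succ_of_lt hjn))
        rw [ih', Finset.sum_Ico_succ_top hn, hA n hn (Nat.lt_succ_self n), eq342_tower T h n hn]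
        abel

/-- **(3.33) p. 617 with the first step**: if moreover the initial field on T_ε is translated as in (3.10),
A = A′₀ + a(Lε)⁻²C^{(0),ε}Q*A₁ = A′₀ + α₁G^ε_1Q*₁A₁ (a₁ = a, p. 609; *"the identity G^ε_1 = C^{(0),ε}"*, p. 612 —
definitional in the tower typing, cf. `B1RG242.Tower.display243`), then
A = A′₀ + Σ_{j=1}^{k−1} α_jG_jQ*_jA′_j + α_kG_kQ*_kA_k = A′^{(0),ε} + A′^{(1),ε} + … + A′^{(k−1),ε} + A^{(k),ε},
with A′^{(0),ε} := A′₀ the first fluctuation field itself. [cite: Balaban1982Higgs1, (3.33) p.617] -/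
theorem eq333_from_level_zero (h : T.Consistent) (A₀ A₀' : ι → ℝ) (A A' : ∀ j, T.κ j → ℝ) (k : ℕ) (hk : 1 ≤ k)
    (h0 : A₀ = A₀' + T.α 1 • ((T.G 1 * T.Qks 1) *ᵥ A 1))
    (hA : ∀ j, 1 ≤ j → j < k → A j = A' j + T.β j • (T.C j *ᵥ (T.Qs j *ᵥ A (j + 1)))) :
    A₀ = A₀' + (∑ j ∈ Finset.Ico 1 k, T.α j • ((T.G j * T.Qks j) *ᵥ A' j))
      + T.α k • ((T.G k * T.Qks k) *ᵥ A k) := by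
  rw [h0, eq333 T h A A' k hk hA, add_assoc]

end AllSteps

end Literature.MathematicalPhysics.QuantumFieldTheory.Balaban1983to89.B1Eq333Decomposition
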